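import Summits.MatrixMultiplication.MatrixMultiplication.Theorems.ObstructionDescentUniversalOccurrenceShortLeg
import Summits.MatrixMultiplication.MatrixMultiplication.Theorems.ObstructionDescentUniversalOccurrenceRectangleMonotone
import Summits.MatrixMultiplication.MatrixMultiplication.Theorems.ObstructionCalculusSchurWeylConverse
import Summits.MatrixMultiplication.MatrixMultiplication.Theorems.ObstructionDescentCoordinateDegree
import Literature.Computability.AlgebraicComplexity.BI17TensorNonNormalityCriterion

set_option linter.dupNamespace false
set_option autoImplicit false

/-!
# Universal occurrence — the hypersurface blindness law and `UOCC(18,7)` (decomp-mm · lens 3 · gen 40)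

Route `route-MatrixMultiplication-ObstructionDescent` (sub-problem `MatrixMultiplication`, `ω(ℂ) = 2`); SUPPORT for the crux
`NoOccurrenceObstruction` (`P_O`, item `stmt-MatrixMultiplication-29040`) through the universal-occurrence ladder `u(N)` (NODE-g39 §6,
NODE-g40): `UOCC(R,N)` = "every type occurring for SOME tensor of format `N³` occurs for the unit tensor `⟨R⟩`".  Nothing here proves
`ω = 2` or closes an item; no `def`, no `sorry`, standard axioms.  Stated in the LANDED calculus (`hwvSpace Λ d` = Borel weight vectors
of type `Λ` in degree `d` on `ℂ^N ⊗ ℂ^N ⊗ ℂ^N`, `orbitVanishing`, `evalT`) and BI 2017's invariant spaces (`sl3InvariantsOfDegree`, `kronRect`).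

**Law (§1–§3, unconditional).**  `F` a PRIME weight vector of type `κ`, `F'` a weight vector of the same type with `F ∤ F'` (an
ESCAPE PARTNER) ⟹ every non-zero weight space `W_{Λ,d}` contains a non-zero vector NOT divisible by `F` (`exists_mem_hwvSpace_not_dvd`).
Ingredients: cofactors of homogeneous polynomials are homogeneous (`isHomogeneous_of_mul_left`); DESCENT (`exists_mem_hwvSpace_of_mul_mem`):
`F·x ∈ W_Λ` ⟹ `κ ≤ Λ` (weight law on a monomial of `F·x`) and `x ∈ W_{Λ−κ}` (the identities `K·(Fx) = χ_Λ·Fx`, `K·F = χ_κ·F` of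
`linSubst_eq_smul_of_mem_hwvSpace`, cancellation in the domain `ℂ[x]`, `χ_κ ≠ 0` on the Borel subgroup); strong induction on the
degree with `y = F'·y'`.  An escape partner exists as soon as `dim ≥ 2` (`exists_mem_not_dvd_of_two_le_finrank`).

**Chain (§4–§5).**  `uocc_of_principal_hwvIdeal`: if every weight vector vanishing on `{algBorderRank ≤ r}` (= `σ_r(N³)`, BCS Thm. 20.3)
is divisible by such an `F`, then `UOCC(r,N)` (`exists_occurs_of_kroneckerCoeff_pos`, the Schur–Weyl bridges
`not_hwvSpace_le_orbitVanishing_of_isotypicSum_ne_zero` / `isotypicSum_ne_zero_of_not_hwvSpace_le_orbitVanishing`,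
`occurs_unitTensor_of_algBorderRank_le`, `uocc_iff_kroneckerSemigroup_le`).  §5: a homogeneous `SL³`-invariant of degree `Nδ` is a
weight vector of the cube type `((δ^N))³` (`mem_hwvSpace_of_isSL3Invariant`, via BI 2017 Lemma 5.1) and `dim O(⊗³ℂ^N)^{SL³}_{Nδ} = k_N(δ)`,
whence **`uocc_of_hypersurface_invariant`**: `F ∈ O(⊗³ℂ^N)^{SL³}_{Nδ}` prime, `k_N(δ) ≥ 2`, weight vectors of `I(σ_r(N³))` inside `(F)`
⟹ `UOCC(r,N)`.

**The format `(18; 7,7,7)` (§6).**  `7³ − 1 = 342 = 18·(3·7 − 2)`, and `n = 7` is the only `n ≥ 2` with `(3n−2) ∣ (n³−1)`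
(`threeMul_sub_two_dvd_cube_sub_one_iff`): `σ₁₈(ℂ⁷⊗ℂ⁷⊗ℂ⁷) ⊂ ℂ³⁴³` is an irreducible HYPERSURFACE — `dim = 342` by a Terracini rank
certificate mod `p` (pkg-ObstructionDescent-g40/calc; Lickteig 1985: typical rank `19`) — so its ideal is a height-one prime `(F)` of the UFD
`ℂ[x]`, and the generator is `GL₇³`-semi-invariant, i.e. `F ∈ O(⊗³ℂ⁷)^{SL³}_{7δ}` (`δ ≥ 4` by `E(7) = {0,28,35,…}`, tree).  The escape
partner needs `k_7(δ) ≥ 2`: `k_7(4) = 14`, `k_7(5) = 1456` (tree), `k_7(δ) ≥ 14` for `δ ≥ 8`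
(`ObstructionDescentUniversalOccurrenceRectangleMonotone`), and the atoms `k_7(6) = 438744`, `k_7(7) = 125250433` (DATA, two independent
character engines; `k_7(6)` as printed by Amanov–Yeliussizov).  **`uocc_eighteen_seven_of_hypersurface`** (atoms) and
**`uocc_eighteen_seven_of_hypersurface_of_eight_le`** (instead: `deg F ≥ 56`, e.g. HIL13's numerical `I_d(σ₁₈(7³)) = 0` for
`d ≤ 186 999`): GIVEN the prime invariant `F` dividing every weight vector that vanishes on `{algBorderRank ≤ 18}`, universal occurrence
holds at `(18,7)` — `u(7) ≤ 18 < 19 = R_gen(7)`, the first format where occurrence obstructions provably go blind STRICTLY BELOW the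
generic rank (ladder row 7: `[10,19] ↦ [10,18]`).  Outside Lean: "irreducible hypersurface ⟹ principal prime ideal with semi-invariant
generator" (textbook algebra on the certified dimension), and the Kronecker atoms / the degree bound.

[cite: BurgisserIkenmeyer2011, §3.1–3.2, Lemma 3.2, §10.1] [cite: BurgisserIkenmeyer2017, §5, Lemma 5.1, Ex. 5.6]
[cite: BurgisserClausenShokrollahi1997, Thm. 20.3, Lemma 20.10] [cite: Lickteig1985] [cite: Landsberg2017, §8.3.2 (p. 226)]
[cite: AmanovYeliussizov2022, §9 Table 4]
-/

open scoped BigOperators Pointwise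

namespace Summit.MatrixMultiplication.MatrixMultiplication.Theorems.ObstructionCalculus

open Literature.Computability.AlgebraicComplexity (actTensor actTensor_one kroneckerPow isotypicSum₁ isotypicSum₂ isotypicSum₃
  unitTensor linSubst algBorderRank tensorPt tensorChi IsSL3Invariant sl3InvariantsOfDegree mem_sl3InvariantsOfDegree_iff kronRect
  finite_sl3InvariantsOfDegree finrank_sl3InvariantsOfDegree_eq_kronRect sl3InvariantsOfDegree_ne_bot_iff_kronRect_pos
  genericTensorDegreeMonoid_eq_kronRect exists_occurs_of_kroneckerCoeff_pos)
open Literature.NumberTheory.DiophantineGeometry (kroneckerCoeff)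
open Summit.MatrixMultiplication.MatrixMultiplication.Theorems.ObstructionDescentTorusLaws (wt cellWt)

variable {m : ℕ}

/-! ### §1 Cofactors of homogeneous polynomials are homogeneous -/

/-- In `K[x]` (a domain), if `F ≠ 0` is homogeneous of degree `D` and `F·x` is homogeneous of degree `d`, then `x` is
homogeneous of degree `d − D` (compare homogeneous components: `(F·x)_{D+i} = F·x_i`). [folklore] -/
theorem isHomogeneous_of_mul_left {σ K : Type*} [Field K] {F x : MvPolynomial σ K} {D d : ℕ}
    (hF : F.IsHomogeneous D) (hF0 : F ≠ 0) (hFx : (F * x).IsHomogeneous d) : x.IsHomogeneous (d - D) := by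
  classical
  have hcomp : ∀ i, D + i ≠ d → MvPolynomial.homogeneousComponent i x = 0 := by
    intro i hi
    have h1 : MvPolynomial.homogeneousComponent (D + i) (F * x) = F * MvPolynomial.homogeneousComponent i x := by
      conv_lhs => rw [← MvPolynomial.sum_homogeneousComponent x, Finset.mul_sum, map_sum]
      rw [Finset.sum_eq_single i]
      · rw [MvPolynomial.homogeneousComponent_of_mem ((MvPolynomial.mem_homogeneousSubmodule _ _).2
          (hF.mul (MvPolynomial.homogeneousComponent_isHomogeneous i x))), if_pos rfl]
      · intro j _ hji
        rw [MvPolynomial.homogeneousComponent_of_mem ((MvPolynomial.mem_homogeneousSubmodule _ _).2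
          (hF.mul (MvPolynomial.homogeneousComponent_isHomogeneous j x))), if_neg (by omega)]
      · intro hi'
        rw [Finset.mem_range, not_lt] at hi'; rw [MvPolynomial.homogeneousComponent_eq_zero i x (by omega), mul_zero, map_zero]
    have h2 : MvPolynomial.homogeneousComponent (D + i) (F * x) = 0 := by
      rw [MvPolynomial.homogeneousComponent_of_mem ((MvPolynomial.mem_homogeneousSubmodule _ _).2 hFx), if_neg hi]
    rw [h2] at h1
    exact (mul_eq_zero.1 h1.symm).resolve_left hF0
  by_cases hD : D ≤ d
  · have hx : x = MvPolynomial.homogeneousComponent (d - D) x := by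
      conv_lhs => rw [← MvPolynomial.sum_homogeneousComponent x]
      rw [Finset.sum_eq_single (d - D)]
      · intro j _ hj
        exact hcomp j (by omega)
      · intro h'
        rw [Finset.mem_range, not_lt] at h'; exact MvPolynomial.homogeneousComponent_eq_zero (d - D) x (by omega)
    rw [hx]; exact MvPolynomial.homogeneousComponent_isHomogeneous _ _
  · have hx : x = 0 := by
      rw [← MvPolynomial.sum_homogeneousComponent x]
      exact Finset.sum_eq_zero fun j _ => hcomp j (by omega)
    rw [hx]; exact MvPolynomial.isHomogeneous_zero _ _ _

/-- A multiple `F' = F·q` of a homogeneous `F ≠ 0` with `deg F' = deg F` is a scalar multiple; hence a subspace `W` of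
homogeneous polynomials of degree `D` with `dim W ≥ 2` contains an element NOT divisible by `F` (an ESCAPE PARTNER of `F`).
[folklore] -/
theorem exists_mem_not_dvd_of_two_le_finrank {σ : Type*} {D : ℕ} {W : Submodule ℂ (MvPolynomial σ ℂ)}
    [Module.Finite ℂ W] (hW : ∀ G ∈ W, G.IsHomogeneous D) (h2 : 2 ≤ Module.finrank ℂ W)
    {F : MvPolynomial σ ℂ} (hF : F.IsHomogeneous D) (hF0 : F ≠ 0) : ∃ F' ∈ W, ¬ F ∣ F' := by
  classical
  by_contra hall
  push Not at hall
  have hle : W ≤ Submodule.span ℂ {F} := by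
    intro F' hF'
    obtain ⟨q, hq⟩ := hall F' hF'
    have hqh : q.IsHomogeneous (D - D) := isHomogeneous_of_mul_left hF hF0 (hq ▸ hW F' hF')
    rw [Nat.sub_self] at hqh
    have hqC : q = MvPolynomial.C (q.coeff 0) := by
      apply MvPolynomial.totalDegree_eq_zero_iff_eq_C.1
      by_cases hq0 : q = 0
      · rw [hq0, MvPolynomial.totalDegree_zero]
      · exact hqh.totalDegree hq0
    rw [hq, hqC, mul_comm, ← MvPolynomial.smul_eq_C_mul]
    exact Submodule.smul_mem _ _ (Submodule.subset_span rfl)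
  have h1 : Module.finrank ℂ W ≤ 1 := by
    calc Module.finrank ℂ W ≤ Module.finrank ℂ (Submodule.span ℂ ({F} : Set (MvPolynomial σ ℂ))) :=
          Submodule.finrank_mono hle
      _ = 1 := finrank_span_singleton hF0
  omega

/-! ### §2 Descent of the Borel weight through a weight-vector factor -/

/-- The torus weight of exponents is additive. [bookkeeping] -/
theorem wt_add (a b : Idx m →₀ ℕ) : wt (a + b) = wt a + wt b :=
  Finsupp.sum_add_index' (fun p => zero_smul ℕ (cellWt p)) (fun p k₁ k₂ => add_smul k₁ k₂ (cellWt p))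

/-- **Weights of factors.**  If `F ∈ W_{κ,D}` and `F·x ∈ W_{Λ,d}` is non-zero then `κ ≤ Λ` entrywise: a monomial of `F·x`
is a product of monomials of `F` and `x`, and monomials of weight vectors carry the torus weight of their type
(`wt_eq_of_mem_support`). [cite: BurgisserIkenmeyer2011, §3.1] -/
theorem weight_le_of_mul_mem_hwvSpace {κ Λ : Fin 3 → Fin m → ℕ} {D d : ℕ} {F x : MvPolynomial (Idx m) ℂ}
    (hF : F ∈ hwvSpace κ D) (hFx : F * x ∈ hwvSpace Λ d) (h0 : F * x ≠ 0) : ∀ s i, κ s i ≤ Λ s i := by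
  classical
  obtain ⟨μ, hμ⟩ := MvPolynomial.ne_zero_iff.1 h0
  have hμ' : μ ∈ (F * x).support := MvPolynomial.mem_support_iff.2 hμ
  obtain ⟨a, ha, b, -, hab⟩ := Finset.mem_add.1 (MvPolynomial.support_mul F x hμ')
  have hwμ := wt_eq_of_mem_support hFx hμ'
  rw [← hab, wt_add, wt_eq_of_mem_support hF ha] at hwμ
  have key : ∀ w, (Finsupp.equivFunOnFinite.symm (Sum.elim (κ 0) (Sum.elim (κ 1) (κ 2)))) w ≤
      (Finsupp.equivFunOnFinite.symm (Sum.elim (Λ 0) (Sum.elim (Λ 1) (Λ 2)))) w := fun w => by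
    rw [← hwμ, Finsupp.add_apply]
    exact Nat.le_add_right _ _
  intro s i
  fin_cases s
  · simpa using key (Sum.inl i)
  · simpa using key (Sum.inr (Sum.inl i))
  · simpa using key (Sum.inr (Sum.inr i))

/-- A weight vector that is prime has positive degree (degree `0` weight vectors are the units `c ≠ 0`). [bookkeeping] -/
theorem degree_pos_of_prime_mem_hwvSpace {κ : Fin 3 → Fin m → ℕ} {D : ℕ} {F : MvPolynomial (Idx m) ℂ}
    (hF : F ∈ hwvSpace κ D) (hp : Prime F) : 0 < D := by
  by_contra hD
  have hD0 : D = 0 := by omega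
  have htd : F.totalDegree = 0 := by rw [hF.1.totalDegree hp.ne_zero, hD0]
  have hC : F = MvPolynomial.C (F.coeff 0) := MvPolynomial.totalDegree_eq_zero_iff_eq_C.1 htd
  have hc0 : F.coeff 0 ≠ 0 := fun h0 => hp.ne_zero (by rw [hC, h0, map_zero])
  exact hp.not_unit (by rw [hC]; exact (isUnit_iff_ne_zero.mpr hc0).map MvPolynomial.C)

/-- **Descent.**  If `F ∈ W_{κ,D}` and `F·x ∈ W_{Λ,d}` is non-zero, then `Λ = κ + Λ'`, `d = D + d'` and `x ∈ W_{Λ',d'}`: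
the cofactor of a weight vector in a weight vector is a weight vector of the complementary type.  (Semi-invariance as polynomial
identities `K·(F x) = χ_Λ·(F x)`, `K·F = χ_κ·F`, `K` the Kronecker substitution of a Borel triple; cancel `F` in the domain
`ℂ[x]`; divide the characters, `χ_κ ≠ 0` on the Borel subgroup.) [cite: BurgisserIkenmeyer2011, §3.1, §10.1] -/
theorem exists_mem_hwvSpace_of_mul_mem {κ Λ : Fin 3 → Fin m → ℕ} {D d : ℕ} {F x : MvPolynomial (Idx m) ℂ}
    (hF : F ∈ hwvSpace κ D) (hFx : F * x ∈ hwvSpace Λ d) (h0 : F * x ≠ 0) :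
    ∃ (Λ' : Fin 3 → Fin m → ℕ) (d' : ℕ), Λ = κ + Λ' ∧ d = D + d' ∧ x ∈ hwvSpace Λ' d' := by
  classical
  have hF0 : F ≠ 0 := left_ne_zero_of_mul h0
  have hle := weight_le_of_mul_mem_hwvSpace hF hFx h0
  have hxh : x.IsHomogeneous (d - D) := isHomogeneous_of_mul_left hF.1 hF0 hFx.1
  have hdeg : d = D + (d - D) := hFx.1.inj_right (hF.1.mul hxh) h0
  have hsum : κ + (Λ - κ) = Λ := by
    funext s i
    simp only [Pi.add_apply, Pi.sub_apply]
    exact Nat.add_sub_cancel' (hle s i)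
  refine ⟨Λ - κ, d - D, hsum.symm, hdeg, hxh, fun A B C hA hB hC t => ?_⟩
  have h1 := linSubst_eq_smul_of_mem_hwvSpace hFx hA hB hC
  rw [map_mul, linSubst_eq_smul_of_mem_hwvSpace hF hA hB hC, smul_mul_assoc, ← mul_smul_comm, ← mul_smul_comm] at h1
  have h4 := mul_left_cancel₀ hF0 h1
  have h5 := congrArg (evalT t) h4
  rw [map_smul, map_smul, evalT_linSubst, smul_eq_mul, smul_eq_mul, ← hsum] at h5
  simp only [Pi.add_apply, weightChar_add] at h5
  have hne : weightChar (κ 0) A * weightChar (κ 1) B * weightChar (κ 2) C ≠ 0 :=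
    mul_ne_zero (mul_ne_zero (weightChar_ne_zero _ hA) (weightChar_ne_zero _ hB)) (weightChar_ne_zero _ hC)
  apply mul_left_cancel₀ hne
  rw [h5]
  ring

/-! ### §3 The hypersurface blindness law -/

/-- **Hypersurface blindness law (escape form).**  Let `F` be a prime weight vector of type `κ` and `F'` a weight vector of the
same type and degree with `F ∤ F'`.  Then every non-zero weight space `W_{Λ,d}` contains a non-zero vector not divisible by `F`.
(Strong induction on `d`: if `F ∣ h`, descend to the cofactor, escape there, and multiply back by `F'`.)  Consequence (informal):
for a secant variety that is a hypersurface `{F = 0}`, NO type occurring at the format fails to occur on it, provided the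
invariant space of `F`'s degree has dimension `≥ 2`. [this node] [cite: BurgisserIkenmeyer2011, §3.1] -/
theorem exists_mem_hwvSpace_not_dvd {κ : Fin 3 → Fin m → ℕ} {D : ℕ} {F F' : MvPolynomial (Idx m) ℂ}
    (hF : F ∈ hwvSpace κ D) (hp : Prime F) (hF' : F' ∈ hwvSpace κ D) (hFF' : ¬ F ∣ F')
    {d : ℕ} {Λ : Fin 3 → Fin m → ℕ} {h : MvPolynomial (Idx m) ℂ} (hh : h ∈ hwvSpace Λ d) (hh0 : h ≠ 0) :
    ∃ y ∈ hwvSpace Λ d, y ≠ 0 ∧ ¬ F ∣ y := by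
  induction d using Nat.strong_induction_on generalizing Λ h with
  | _ d ih =>
    by_cases hdvd : F ∣ h
    · obtain ⟨x, rfl⟩ := hdvd
      obtain ⟨Λ', d', hΛ, hd, hx⟩ := exists_mem_hwvSpace_of_mul_mem hF hh hh0
      have hx0 : x ≠ 0 := right_ne_zero_of_mul hh0
      have hD := degree_pos_of_prime_mem_hwvSpace hF hp
      obtain ⟨y', hy', hy'0, hy'F⟩ := ih d' (by omega) hx hx0
      have hF'0 : F' ≠ 0 := fun h0 => hFF' (h0 ▸ dvd_zero F)
      refine ⟨F' * y', ?_, mul_ne_zero hF'0 hy'0, fun hdiv => (hp.dvd_or_dvd hdiv).elim hFF' hy'F⟩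
      have hmem := mul_mem_hwvSpace hF' hy'
      rwa [← hΛ, ← hd] at hmem
    · exact ⟨h, hh, hh0, hdvd⟩

/-- The law in ideal form: no non-zero weight space lies inside the principal ideal `(F)`. [this node] -/
theorem not_subset_span_singleton_of_escape {κ : Fin 3 → Fin m → ℕ} {D : ℕ} {F F' : MvPolynomial (Idx m) ℂ}
    (hF : F ∈ hwvSpace κ D) (hp : Prime F) (hF' : F' ∈ hwvSpace κ D) (hFF' : ¬ F ∣ F')
    {d : ℕ} {Λ : Fin 3 → Fin m → ℕ} (hne : hwvSpace Λ d ≠ ⊥) :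
    ¬ ((hwvSpace Λ d : Set (MvPolynomial (Idx m) ℂ)) ⊆ (Ideal.span {F} : Set (MvPolynomial (Idx m) ℂ))) := by
  intro hsub
  obtain ⟨h, hh, hh0⟩ := (Submodule.ne_bot_iff _).1 hne
  obtain ⟨y, hy, -, hyF⟩ := exists_mem_hwvSpace_not_dvd hF hp hF' hFF' hh hh0
  exact hyF (Ideal.mem_span_singleton.1 (hsub hy))

/-! ### §4 The chain: a principal weight ideal with an escape partner forces universal occurrence -/

/-- **Universal occurrence from a principal weight ideal.**  Let `N ≤ r`.  Suppose `F` is a prime weight vector on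
`ℂ^N ⊗ ℂ^N ⊗ ℂ^N` with an escape partner `F'` of the same type, and suppose every weight vector vanishing at all tensors of
(algebraic) border rank `≤ r` is divisible by `F` (e.g. `I(σ_r(N³)) = (F)`).  Then `UOCC(r,N)`: every triple occurring in a
Kronecker power of some tensor on at most `N` indices occurs in the same power of `⟨r⟩`.
[this node] [cite: BurgisserIkenmeyer2011, §3.1–3.2] -/
theorem uocc_of_principal_hwvIdeal {N r : ℕ} (hNr : N ≤ r) {κ : Fin 3 → Fin N → ℕ} {D : ℕ}
    {F F' : MvPolynomial (Idx N) ℂ} (hF : F ∈ hwvSpace κ D) (hp : Prime F) (hF' : F' ∈ hwvSpace κ D) (hFF' : ¬ F ∣ F')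
    (hI : ∀ (Λ : Fin 3 → Fin N → ℕ) (d : ℕ) (f : MvPolynomial (Idx N) ℂ), f ∈ hwvSpace Λ d →
      (∀ t : Tensor ℂ N, algBorderRank t ≤ r → evalT t f = 0) → F ∣ f) :
    ∀ {ι : Type} [Fintype ι], Fintype.card ι ≤ N → ∀ (s : ι → ι → ι → ℂ) (d : ℕ) (lam : Fin 3 → Nat.Partition d),
      isotypicSum₁ (lam 0) (isotypicSum₂ (lam 1) (isotypicSum₃ (lam 2) (kroneckerPow s d))) ≠ 0 →
      isotypicSum₁ (lam 0) (isotypicSum₂ (lam 1) (isotypicSum₃ (lam 2) (kroneckerPow (unitTensor ℂ r) d))) ≠ 0 := by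
  refine uocc_iff_kroneckerSemigroup_le.2 fun d lam hcard hg => ?_
  classical
  obtain ⟨s, hs⟩ := exists_occurs_of_kroneckerCoeff_pos hcard hg
  set Λ : Fin 3 → Fin N → ℕ := fun j i => (lam j).sortedParts.getD (Fin.rev i) 0 with hΛdef
  have hΛ : ∀ (j : Fin 3) (i : Fin N), Λ j (Fin.rev i) = (lam j).sortedParts.getD i 0 := fun j i => by
    simp only [hΛdef, Fin.rev_rev]
  have hocc := not_hwvSpace_le_orbitVanishing_of_isotypicSum_ne_zero s lam Λ hΛ hs
  obtain ⟨h, hh, hhs⟩ := SetLike.not_le_iff_exists.1 hocc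
  have hh0 : h ≠ 0 := by rintro rfl; exact hhs (Submodule.zero_mem _)
  obtain ⟨y, hy, -, hyF⟩ := exists_mem_hwvSpace_not_dvd hF hp hF' hFF' hh hh0
  have hex : ∃ t : Tensor ℂ N, algBorderRank t ≤ r ∧ evalT t y ≠ 0 := by
    by_contra hno; push Not at hno; exact hyF (hI Λ d y hy hno)
  obtain ⟨t, ht, hty⟩ := hex
  have hocct : ¬ hwvSpace Λ d ≤ orbitVanishing t := fun hle => not_mem_orbitVanishing_of_evalT_ne_zero hty (hle hy)
  exact occurs_unitTensor_of_algBorderRank_le hNr t ht d lam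
    (isotypicSum_ne_zero_of_not_hwvSpace_le_orbitVanishing t lam Λ hΛ hocct)

/-- The same with the escape partner replaced by the dimension hypothesis `dim W_{κ,D} ≥ 2`. [this node] -/
theorem uocc_of_principal_hwvIdeal_of_two_le_finrank {N r : ℕ} (hNr : N ≤ r) {κ : Fin 3 → Fin N → ℕ} {D : ℕ}
    {F : MvPolynomial (Idx N) ℂ} (hF : F ∈ hwvSpace κ D) (hp : Prime F) (h2 : 2 ≤ Module.finrank ℂ (hwvSpace κ D))
    (hI : ∀ (Λ : Fin 3 → Fin N → ℕ) (d : ℕ) (f : MvPolynomial (Idx N) ℂ), f ∈ hwvSpace Λ d →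
      (∀ t : Tensor ℂ N, algBorderRank t ≤ r → evalT t f = 0) → F ∣ f) :
    ∀ {ι : Type} [Fintype ι], Fintype.card ι ≤ N → ∀ (s : ι → ι → ι → ℂ) (d : ℕ) (lam : Fin 3 → Nat.Partition d),
      isotypicSum₁ (lam 0) (isotypicSum₂ (lam 1) (isotypicSum₃ (lam 2) (kroneckerPow s d))) ≠ 0 →
      isotypicSum₁ (lam 0) (isotypicSum₂ (lam 1) (isotypicSum₃ (lam 2) (kroneckerPow (unitTensor ℂ r) d))) ≠ 0 := by
  haveI := finite_hwvSpace κ D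
  obtain ⟨F', hF', hFF'⟩ := exists_mem_not_dvd_of_two_le_finrank (W := hwvSpace κ D) (fun G hG => hG.1) h2 hF.1 hp.ne_zero
  exact fun {ι} _ hι => uocc_of_principal_hwvIdeal hNr hF hp hF' hFF' hI hι

/-! ### §5 From BI 2017's invariant spaces: `SL³`-invariants are weight vectors of the cube type, `dim = k_N(δ)` -/

/-- On the Borel subgroup the constant character of level `δ` is `det^δ`. [bookkeeping] -/
theorem weightChar_const_eq_det_pow {N : ℕ} (δ : ℕ) {A : Matrix (Fin N) (Fin N) ℂ} (hA : A ∈ borel N) :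
    weightChar (fun _ : Fin N => δ) A = A.det ^ δ := by
  rw [Matrix.det_of_upperTriangular (fun i j h => hA.1 i j h), ← Finset.prod_pow]
  rfl

/-- **A homogeneous `SL³`-invariant of degree `Nδ` is a weight vector of the cube type `((δ^N))³`** (exact semi-invariance
`F(g·v) = (det g₁ det g₂ det g₃)^δ F(v)`, BI 2017 Lemma 5.1, tree `IsSL3Invariant.aeval_tensorPt_actTensor_eq_tensorChi_pow`).
[cite: BurgisserIkenmeyer2017, Lemma 5.1] [cite: BurgisserIkenmeyer2011, §3.2] -/
theorem mem_hwvSpace_of_isSL3Invariant {N δ : ℕ} (hN : 0 < N) {F : MvPolynomial (Idx N) ℂ}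
    (hFh : F.IsHomogeneous (N * δ)) (hinv : IsSL3Invariant F) :
    F ∈ hwvSpace (fun (_ : Fin 3) (_ : Fin N) => δ) (N * δ) := by
  haveI : Nonempty (Fin N) := ⟨⟨0, hN⟩⟩
  refine ⟨hFh, fun A B C hA hB hC t => ?_⟩
  have hFh' : F.IsHomogeneous (Fintype.card (Fin N) * δ) := by rwa [Fintype.card_fin]
  have key := IsSL3Invariant.aeval_tensorPt_actTensor_eq_tensorChi_pow hFh' hinv
    (Matrix.GeneralLinearGroup.mkOfDetNeZero A (det_ne_zero_of_mem_borel hA),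
      Matrix.GeneralLinearGroup.mkOfDetNeZero B (det_ne_zero_of_mem_borel hB),
      Matrix.GeneralLinearGroup.mkOfDetNeZero C (det_ne_zero_of_mem_borel hC)) t
  have key' : evalT (actTensor A B C t) F = (A.det * B.det * C.det) ^ δ * evalT t F := key
  rw [key', weightChar_const_eq_det_pow δ hA, weightChar_const_eq_det_pow δ hB, weightChar_const_eq_det_pow δ hC]
  ring

/-- **Universal occurrence from a hypersurface invariant.**  Let `0 < N ≤ r`, let `F ∈ O(⊗³ℂ^N)^{SL³}_{Nδ}` be PRIME with
`k_N(δ) ≥ 2`, and suppose every weight vector vanishing at all tensors of border rank `≤ r` is divisible by `F` (the case of an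
irreducible hypersurface `σ_r(N³) = {F = 0}`).  Then `UOCC(r,N)`. [this node] [cite: BurgisserIkenmeyer2017, §5 eq. (5.2)] -/
theorem uocc_of_hypersurface_invariant {N r δ : ℕ} (hN : 0 < N) (hNr : N ≤ r) {F : MvPolynomial (Idx N) ℂ}
    (hF : F ∈ sl3InvariantsOfDegree (Fin N) ℂ (N * δ)) (hp : Prime F) (h2 : 2 ≤ kronRect ℂ N δ)
    (hI : ∀ (Λ : Fin 3 → Fin N → ℕ) (d : ℕ) (f : MvPolynomial (Idx N) ℂ), f ∈ hwvSpace Λ d →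
      (∀ t : Tensor ℂ N, algBorderRank t ≤ r → evalT t f = 0) → F ∣ f) :
    ∀ {ι : Type} [Fintype ι], Fintype.card ι ≤ N → ∀ (s : ι → ι → ι → ℂ) (d : ℕ) (lam : Fin 3 → Nat.Partition d),
      isotypicSum₁ (lam 0) (isotypicSum₂ (lam 1) (isotypicSum₃ (lam 2) (kroneckerPow s d))) ≠ 0 →
      isotypicSum₁ (lam 0) (isotypicSum₂ (lam 1) (isotypicSum₃ (lam 2) (kroneckerPow (unitTensor ℂ r) d))) ≠ 0 := by
  have hFh := ((mem_sl3InvariantsOfDegree_iff _ _).1 hF)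
  haveI := finite_sl3InvariantsOfDegree ℂ N δ
  have h2' : 2 ≤ Module.finrank ℂ (sl3InvariantsOfDegree (Fin N) ℂ (N * δ)) := by
    rwa [finrank_sl3InvariantsOfDegree_eq_kronRect ℂ N δ]
  obtain ⟨F', hF', hFF'⟩ := exists_mem_not_dvd_of_two_le_finrank (W := sl3InvariantsOfDegree (Fin N) ℂ (N * δ))
    (fun G hG => ((mem_sl3InvariantsOfDegree_iff _ _).1 hG).1) h2' hFh.1 hp.ne_zero
  have hF'h := ((mem_sl3InvariantsOfDegree_iff _ _).1 hF')
  exact fun {ι} _ hι => uocc_of_principal_hwvIdeal hNr (mem_hwvSpace_of_isSL3Invariant hN hFh.1 hFh.2) hp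
    (mem_hwvSpace_of_isSL3Invariant hN hF'h.1 hF'h.2) hFF' hI hι

/-! ### §6 The format `(18; 7,7,7)`: `u(7) ≤ 18 < 19 = R_gen(7)` -/

/-- `27(n³ − 1) + 19 = (3n − 2)(9n² + 6n + 4)`: so `(3n − 2) ∣ (n³ − 1)` forces `(3n − 2) ∣ 19`, i.e. `n ∈ {1, 7}` — among the
cubic formats `n ≥ 2`, a secant variety `σ_r(n³)` of the expected dimension `r(3n−2)` is a hypersurface only at `(r,n) = (18,7)`
(`18·19 = 342 = 7³ − 1`). [this node] -/
theorem threeMul_sub_two_dvd_cube_sub_one_iff {n : ℕ} (hn : 1 ≤ n) : (3 * n - 2) ∣ (n ^ 3 - 1) ↔ n = 1 ∨ n = 7 := by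
  obtain ⟨k, rfl⟩ : ∃ k, n = k + 1 := ⟨n - 1, by omega⟩
  have h3 : 3 * (k + 1) - 2 = 3 * k + 1 := by omega
  have hc : (k + 1) ^ 3 - 1 = k ^ 3 + 3 * k ^ 2 + 3 * k := by
    rw [show (k + 1) ^ 3 = (k ^ 3 + 3 * k ^ 2 + 3 * k) + 1 by ring, Nat.add_sub_cancel]
  rw [h3, hc]
  constructor
  · intro h
    have hid : 27 * (k ^ 3 + 3 * k ^ 2 + 3 * k) + 19 = (3 * k + 1) * (9 * k ^ 2 + 24 * k + 19) := by ring
    have h27 : (3 * k + 1) ∣ 27 * (k ^ 3 + 3 * k ^ 2 + 3 * k) := h.mul_left 27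
    have hprod : (3 * k + 1) ∣ 27 * (k ^ 3 + 3 * k ^ 2 + 3 * k) + 19 := by
      rw [hid]
      exact dvd_mul_right _ _
    have h19 : (3 * k + 1) ∣ 19 := (Nat.dvd_add_right h27).1 hprod
    rcases (Nat.dvd_prime (by norm_num : Nat.Prime 19)).1 h19 with h1 | h1 <;> omega
  · rintro (h | h)
    · obtain rfl : k = 0 := by omega
      simp
    · obtain rfl : k = 6 := by omega
      norm_num

/-- **`UOCC(18,7)` from the hypersurface `σ₁₈(ℂ⁷⊗ℂ⁷⊗ℂ⁷)`.**  GIVEN a prime `SL³`-invariant `F` of degree `7δ` on `ℂ⁷⊗ℂ⁷⊗ℂ⁷`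
such that every weight vector vanishing at all tensors of border rank `≤ 18` is divisible by `F` (informally: `F` is the
equation of the irreducible hypersurface `σ₁₈(7³) ⊂ ℂ³⁴³` — non-defective by Lickteig 1985, Terracini rank `342` certified in
pkg-ObstructionDescent-g40), and GIVEN the Kronecker atoms `k_7(6) ≥ 2`, `k_7(7) ≥ 2` (data: `438744`, `125250433`), every triple
occurring for some tensor of format `≤ 7` occurs for `⟨18⟩` — occurrence obstructions are blind at `(18,7)` although
`R̲(generic ℂ⁷⊗ℂ⁷⊗ℂ⁷) = 19 > 18`.  (`δ ≥ 4` is forced by `E(7) = {0,28,35,…}`; `k_7(δ) ≥ 2` then by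
`two_le_kronRect_seven_of_atoms`.) [this node] [cite: Lickteig1985] [cite: BurgisserIkenmeyer2017, Ex. 5.6]
[cite: Landsberg2017, §8.3.2] -/
theorem uocc_eighteen_seven_of_hypersurface {δ : ℕ} {F : MvPolynomial (Idx 7) ℂ}
    (hF : F ∈ sl3InvariantsOfDegree (Fin 7) ℂ (7 * δ)) (hp : Prime F)
    (hI : ∀ (Λ : Fin 3 → Fin 7 → ℕ) (d : ℕ) (f : MvPolynomial (Idx 7) ℂ), f ∈ hwvSpace Λ d →
      (∀ t : Tensor ℂ 7, algBorderRank t ≤ 18 → evalT t f = 0) → F ∣ f)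
    (h6 : 2 ≤ kronRect ℂ 7 6) (h7 : 2 ≤ kronRect ℂ 7 7) :
    ∀ {ι : Type} [Fintype ι], Fintype.card ι ≤ 7 → ∀ (s : ι → ι → ι → ℂ) (d : ℕ) (lam : Fin 3 → Nat.Partition d),
      isotypicSum₁ (lam 0) (isotypicSum₂ (lam 1) (isotypicSum₃ (lam 2) (kroneckerPow s d))) ≠ 0 →
      isotypicSum₁ (lam 0) (isotypicSum₂ (lam 1) (isotypicSum₃ (lam 2) (kroneckerPow (unitTensor ℂ 18) d))) ≠ 0 := by
  have hFh := ((mem_sl3InvariantsOfDegree_iff _ _).1 hF)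
  -- `δ ≥ 4`: `F ≠ 0` lives in degree `7δ ∈ E(7)` and `7δ > 0` (a prime has positive degree)
  have hpos : 0 < kronRect ℂ 7 δ := by
    refine (sl3InvariantsOfDegree_ne_bot_iff_kronRect_pos ℂ 7 δ).1 ?_
    exact (Submodule.ne_bot_iff _).2 ⟨F, hF, hp.ne_zero⟩
  have hD : 0 < 7 * δ := degree_pos_of_prime_mem_hwvSpace (mem_hwvSpace_of_isSL3Invariant (by norm_num) hFh.1 hFh.2) hp
  have hmem : 7 * δ ∈ Literature.Computability.AlgebraicComplexity.genericTensorDegreeMonoid (Fin 7) ℂ := by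
    rw [genericTensorDegreeMonoid_eq_kronRect 7]
    exact ⟨δ, rfl, hpos⟩
  obtain ⟨δ', hδ', h4⟩ := exists_eq_seven_mul_of_mem_genericTensorDegreeMonoid_seven hmem (by omega)
  have hδ : 4 ≤ δ := by omega
  exact fun {ι} _ hι =>
    uocc_of_hypersurface_invariant (by norm_num) (by norm_num) hF hp (two_le_kronRect_seven_of_atoms h6 h7 hδ) hI hι

/-- The same with the escape partner discharged by a DEGREE bound instead of the atoms: if the hypersurface equation has degree
`7δ ≥ 56` (e.g. HIL13: `I_d(σ₁₈(7³)) = 0` for all `d ≤ 186 999`, numerical), then `k_7(δ) ≥ 14` from the tree's `k_7(4) = 14`,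
`k_7(5) = 1456` alone (`fourteen_le_kronRect_seven_of_eight_le`). [this node] [cite: HauensteinIkenmeyerLandsberg2013]
[cite: Landsberg2017, §8.3.2 (p. 226)] -/
theorem uocc_eighteen_seven_of_hypersurface_of_eight_le {δ : ℕ} (hδ : 8 ≤ δ) {F : MvPolynomial (Idx 7) ℂ}
    (hF : F ∈ sl3InvariantsOfDegree (Fin 7) ℂ (7 * δ)) (hp : Prime F)
    (hI : ∀ (Λ : Fin 3 → Fin 7 → ℕ) (d : ℕ) (f : MvPolynomial (Idx 7) ℂ), f ∈ hwvSpace Λ d →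
      (∀ t : Tensor ℂ 7, algBorderRank t ≤ 18 → evalT t f = 0) → F ∣ f) :
    ∀ {ι : Type} [Fintype ι], Fintype.card ι ≤ 7 → ∀ (s : ι → ι → ι → ℂ) (d : ℕ) (lam : Fin 3 → Nat.Partition d),
      isotypicSum₁ (lam 0) (isotypicSum₂ (lam 1) (isotypicSum₃ (lam 2) (kroneckerPow s d))) ≠ 0 →
      isotypicSum₁ (lam 0) (isotypicSum₂ (lam 1) (isotypicSum₃ (lam 2) (kroneckerPow (unitTensor ℂ 18) d))) ≠ 0 :=
  fun {ι} _ hι => uocc_of_hypersurface_invariant (by norm_num) (by norm_num) hF hp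
    (le_trans (by norm_num) (fourteen_le_kronRect_seven_of_eight_le hδ)) hI hι

end Summit.MatrixMultiplication.MatrixMultiplication.Theorems.ObstructionCalculus
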